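import Literature.NumberTheory.Sieve.PolynomialCongruencesRoughAP
import Literature.NumberTheory.Sieve.PolynomialCongruencesLemmas
import HarnessLib

/-!
# The values of an integer polynomial along an arithmetic progression as a sifted sequence

Topic `Literature/NumberTheory/Sieve`, companion of `LevelOfDistribution.lean` / `SieveFramework.lean`
(the `SieveSequence` layer: weights `a_v ≥ 0` on the VALUES `v`, size `X`, multiplicative density
`g`, `A_m = g(m) X + R_m`, sifting function `S(𝒜, P)`, `V(P) = ∏_{p ∣ P} (1 − g(p))`, to which the
tree's Fundamental Lemma `SieveSequence.fundamental_lemma_uniform_holds` applies). Everything here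
is PROVED and elementary, and fully general in `f ∈ ℤ[X]`, `N`, `q`, `r`; the first client is the
sieve-theoretic part (§6A, (6.1)) of Granville–Mollin, *Rabinowitsch revisited*, Acta Arith. 96
(2000), Theorem 4 (`Literature.Barriers.Parity.GranvilleMollin2000_thm4`), whose two counting
problems are exactly

  `#{n ≤ N : n ≡ r (mod q), (f(n), P(z)) = 1}` and `#{n ≤ N : n ≡ r (mod q), m ∣ f(n)}`.

* `apIndex N q r = {1 ≤ n ≤ N : n ≡ r (mod q)}` (`q = 1`: all of `(0, N]`, `apIndex_one`). NOTE:
  the index runs over `(0, N]`, whereas the tree's `polyPrimeCount` (and Granville–Mollin's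
  Corollary 1 / Theorem 3 convention) counts `n = 0, …, N`; a client must absorb the term `n = 0`.
* `rootDensity f` — the arithmetic function `m ↦ ω_f(m)/m`, `ω_f(m) = #{s mod m : f(s) ≡ 0}`
  the tree's `polyRootCountMod ![f] m`; multiplicative (`isMultiplicative_rootDensity`, from the
  tree's CRT lemma `polyRootCountMod_mul_of_coprime`). (`IwaniecAlmostPrimesProp2Prep.rhoDivArith`
  is the case `f = X² + 1`.)
* `polyAPSeq f N q r : SieveSequence` — `a_v = #{n ∈ apIndex N q r : f(n) = v}`, `X = N/q`,
  `g = rootDensity f`; its dictionary `sum_filter_polyAPSeq_a_eq_card`, `polyAPSeq_sifted`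
  (`S(𝒜, P; x) = #{n : (f(n), P) = 1}` once `0 < f(n) ≤ x` on the index set),
  `polyAPSeq_congrSum` (`A_m(x) = #{n : m ∣ f(n)}`), `polyAPSeq_densityProduct`
  (`V(P(z)) = ∏_{p < z} (1 − ω_f(p)/p)`).
* `card_filter_dvd_eval_eq_sum` — `#{n ∈ S : m ∣ f(n)} = ∑_{s mod m, m ∣ f(s)} #{n ∈ S : n ≡ s (m)}`
  (the residues are counted by the tree's `card_filter_dvd_eval_eq_polyRootCountMod`).
* `abs_card_apIndex_filter_modEq_sub_le` — for `(q, m) = 1`, a class mod `m` meets the progression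
  `r mod q` in `(0, N]` in `N/(qm) + O(1)` points (CRT and the tree's
  `abs_card_Ioc_filter_modEq_sub_le`), whence the remainder bound
  `abs_remainder_polyAPSeq_le`: `|R_m(x)| ≤ ω_f(m)` for `m ≥ 1` coprime to `q` — the classical
  remainder estimate for polynomial sequences (Halberstam–Richert, *Sieve Methods*, Ch. 1: the
  progression is their Example 3; the bound `|R_d| ≤ ω(d)` for the values of a polynomial is the
  standard computation of their §1.4, not re-verified against the book, which is not held).

[cite: GranvilleMollin2000, §6A (6.1)] [folklore]
-/

noncomputable section

open Finset Polynomial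

namespace Literature.NumberTheory.Sieve

/-! ### The index set: a residue class in `(0, N]` -/

/-- `apIndex N q r = {n : 1 ≤ n ≤ N, n ≡ r (mod q)}`. [folklore] -/
def apIndex (N q r : ℕ) : Finset ℕ :=
  (Ioc 0 N).filter fun n : ℕ => n ≡ r [MOD q]

/-- Membership in `apIndex`. [folklore] -/
theorem mem_apIndex {N q r n : ℕ} : n ∈ apIndex N q r ↔ (0 < n ∧ n ≤ N) ∧ n ≡ r [MOD q] := by
  simp [apIndex, Finset.mem_filter, Finset.mem_Ioc]

/-- With `q = 1` the index set is all of `(0, N]`. [folklore] -/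
theorem apIndex_one (N r : ℕ) : apIndex N 1 r = Ioc 0 N :=
  Finset.filter_true_of_mem fun _ _ => Nat.modEq_one

/-- `apIndex N q r ⊆ (0, N]`. [folklore] -/
theorem apIndex_subset (N q r : ℕ) : apIndex N q r ⊆ Ioc 0 N :=
  Finset.filter_subset _ _

/-- The progression has `N/q + O(1)` terms: `|#apIndex N q r − N/q| ≤ 1` for `q ≥ 1`. [folklore] -/
theorem abs_card_apIndex_sub_le {q : ℕ} (hq : 0 < q) (N r : ℕ) :
    |(#(apIndex N q r) : ℝ) - N / q| ≤ 1 :=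
  abs_card_Ioc_filter_modEq_sub_le hq N r

/-- `#apIndex N q r ≤ N/q + 1`. [folklore] -/
theorem card_apIndex_le {q : ℕ} (hq : 0 < q) (N r : ℕ) : (#(apIndex N q r) : ℝ) ≤ N / q + 1 := by
  have := (abs_le.mp (abs_card_apIndex_sub_le hq N r)).2
  linarith

/-! ### The root-count density `ω_f(m)/m` -/

/-- `rootDensity f m = ω_f(m)/m` with `ω_f(m) = #{0 ≤ s < m : m ∣ f(s)}` (the tree's
`polyRootCountMod ![f] m`), as an arithmetic function (`0` at `m = 0`). [folklore] -/
def rootDensity (f : ℤ[X]) : ArithmeticFunction ℝ :=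
  ⟨fun m => (polyRootCountMod ![f] m : ℝ) / m, by simp⟩

/-- Unfolding lemma. [folklore] -/
theorem rootDensity_apply (f : ℤ[X]) (m : ℕ) :
    rootDensity f m = (polyRootCountMod ![f] m : ℝ) / m := rfl

/-- `0 ≤ ω_f(m)/m`. [folklore] -/
theorem rootDensity_nonneg (f : ℤ[X]) (m : ℕ) : 0 ≤ rootDensity f m := by
  rw [rootDensity_apply]; positivity

/-- `ω_f(m)/m ≤ 1`. [folklore] -/
theorem rootDensity_le_one (f : ℤ[X]) (m : ℕ) : rootDensity f m ≤ 1 := by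
  rw [rootDensity_apply]
  rcases Nat.eq_zero_or_pos m with rfl | hm
  · simp
  · rw [div_le_one (by exact_mod_cast hm)]
    exact_mod_cast polyRootCountMod_le ![f] m

/-- `m ↦ ω_f(m)/m` is multiplicative (Chinese remainder theorem, via the tree's
`polyRootCountMod_mul_of_coprime`). [folklore] -/
theorem isMultiplicative_rootDensity (f : ℤ[X]) : (rootDensity f).IsMultiplicative := by
  refine ⟨?_, ?_⟩
  · rw [rootDensity_apply, polyRootCountMod_single]; simp
  · intro m n hmn
    rw [rootDensity_apply, rootDensity_apply, rootDensity_apply,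
      polyRootCountMod_mul_of_coprime f hmn]
    push_cast
    rw [mul_div_mul_comm]

/-! ### Divisibility of polynomial values by residues -/

/-- `m ∣ f(n) ↔ m ∣ f(n mod m)` (`m ∣ n − (n mod m) ∣ f(n) − f(n mod m)`). [folklore] -/
theorem dvd_eval_iff_dvd_eval_mod (f : ℤ[X]) (m n : ℕ) :
    (m : ℤ) ∣ f.eval (n : ℤ) ↔ (m : ℤ) ∣ f.eval ((n % m : ℕ) : ℤ) := by
  refine dvd_iff_dvd_of_dvd_sub
    (dvd_trans ⟨((n / m : ℕ) : ℤ), ?_⟩ (Polynomial.sub_dvd_eval_sub (n : ℤ) ((n % m : ℕ) : ℤ) f))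
  have h := Nat.div_add_mod n m
  zify at h
  push_cast at h ⊢
  linarith

/-- Partition by the residue of `n` modulo `m ≥ 1`:
`#{n ∈ S : m ∣ f(n)} = ∑_{0 ≤ s < m, m ∣ f(s)} #{n ∈ S : n ≡ s (mod m)}`. [folklore] -/
theorem card_filter_dvd_eval_eq_sum (f : ℤ[X]) (S : Finset ℕ) {m : ℕ} (hm : 0 < m) :
    #(S.filter fun n : ℕ => (m : ℤ) ∣ f.eval (n : ℤ)) =
      ∑ s ∈ (range m).filter (fun s : ℕ => (m : ℤ) ∣ f.eval (s : ℤ)),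
        #(S.filter fun n : ℕ => n ≡ s [MOD m]) := by
  rw [Finset.card_eq_sum_card_fiberwise (f := fun n : ℕ => n % m)
    (t := (range m).filter (fun s : ℕ => (m : ℤ) ∣ f.eval (s : ℤ))) ?_]
  · refine Finset.sum_congr rfl fun s hs => ?_
    obtain ⟨hsm, hsd⟩ := Finset.mem_filter.mp hs
    rw [Finset.mem_range] at hsm
    congr 1
    ext n
    simp only [Finset.mem_filter, Nat.ModEq, Nat.mod_eq_of_lt hsm]
    constructor
    · rintro ⟨⟨hn, -⟩, hmod⟩
      exact ⟨hn, hmod⟩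
    · rintro ⟨hn, hmod⟩
      refine ⟨⟨hn, ?_⟩, hmod⟩
      rw [dvd_eval_iff_dvd_eval_mod, hmod]
      exact hsd
  · intro n hn
    rw [Finset.mem_coe, Finset.mem_filter] at hn
    rw [Finset.mem_coe, Finset.mem_filter, Finset.mem_range]
    exact ⟨Nat.mod_lt n hm, (dvd_eval_iff_dvd_eval_mod f m n).mp hn.2⟩

/-! ### A residue class against the progression -/

/-- For `(q, m) = 1`, `q, m ≥ 1`: the class `s mod m` meets `{1 ≤ n ≤ N : n ≡ r (mod q)}` in
`N/(qm) + O(1)` points, `|#{n ∈ apIndex N q r : n ≡ s (m)} − N/(qm)| ≤ 1` (Chinese remainder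
theorem: the two congruences form one class modulo `qm`). [folklore] -/
theorem abs_card_apIndex_filter_modEq_sub_le {q m : ℕ} (hq : 0 < q) (hm : 0 < m)
    (hqm : q.Coprime m) (N r s : ℕ) :
    |(#((apIndex N q r).filter fun n : ℕ => n ≡ s [MOD m]) : ℝ) - N / ((q : ℝ) * m)| ≤ 1 := by
  obtain ⟨c, hcq, hcm⟩ := Nat.chineseRemainder hqm r s
  have hset : (apIndex N q r).filter (fun n : ℕ => n ≡ s [MOD m]) =
      (Ioc 0 N).filter (fun n : ℕ => n ≡ c [MOD q * m]) := by
    unfold apIndex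
    rw [Finset.filter_filter]
    refine Finset.filter_congr fun n _ => ?_
    rw [← Nat.modEq_and_modEq_iff_modEq_mul hqm]
    constructor
    · rintro ⟨h1, h2⟩
      exact ⟨h1.trans hcq.symm, h2.trans hcm.symm⟩
    · rintro ⟨h1, h2⟩
      exact ⟨h1.trans hcq, h2.trans hcm⟩
  rw [hset]
  have h := abs_card_Ioc_filter_modEq_sub_le (Nat.mul_pos hq hm) N c
  push_cast at h
  exact h

/-! ### The sifted sequence of the values `f(n)`, `n ≡ r (mod q)`, `n ≤ N` -/

/-- `polyAPSeq f N q r`: the values `f(n)`, `n ∈ apIndex N q r`, as a sifted sequence on the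
values — weights `a_v = #{n ∈ apIndex N q r : f(n) = v}` (`v ≥ 1`), expected size `X = N/q`,
density `g(m) = ω_f(m)/m` (Halberstam–Richert Ch. 1, Examples 3 and 5). [folklore] -/
def polyAPSeq (f : ℤ[X]) (N q r : ℕ) : SieveSequence where
  a v := ((#((apIndex N q r).filter fun n : ℕ => f.eval (n : ℤ) = (v : ℤ)) : ℕ) : ℝ)
  a_nonneg _ := Nat.cast_nonneg _
  size _ := (N : ℝ) / q
  density := rootDensity f
  density_mult := isMultiplicative_rootDensity f

/-- Unfolding lemma for the weights. [folklore] -/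
theorem polyAPSeq_a (f : ℤ[X]) (N q r v : ℕ) :
    (polyAPSeq f N q r).a v = #((apIndex N q r).filter fun n : ℕ => f.eval (n : ℤ) = (v : ℤ)) :=
  rfl

/-- Unfolding lemma for the size. [folklore] -/
theorem polyAPSeq_size (f : ℤ[X]) (N q r : ℕ) (x : ℝ) :
    (polyAPSeq f N q r).size x = (N : ℝ) / q := rfl

/-- Unfolding lemma for the density. [folklore] -/
theorem polyAPSeq_density (f : ℤ[X]) (N q r : ℕ) :
    (polyAPSeq f N q r).density = rootDensity f := rfl

/-- **Counting through the values.** If `0 < f(n) ≤ x` for all `n` in the index set, then for any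
property `Q` of the value, `∑_{1 ≤ v ≤ x, Q(v)} a_v = #{n ∈ apIndex N q r : Q(|f(n)|)}`. [folklore] -/
theorem sum_filter_polyAPSeq_a_eq_card (f : ℤ[X]) (N q r : ℕ) {x : ℝ}
    (hx : ∀ n ∈ apIndex N q r, 0 < f.eval (n : ℤ) ∧ ((f.eval (n : ℤ) : ℤ) : ℝ) ≤ x)
    (Q : ℕ → Prop) [DecidablePred Q] :
    ∑ v ∈ (Ioc 0 ⌊x⌋₊).filter Q, (polyAPSeq f N q r).a v =
      #((apIndex N q r).filter fun n : ℕ => Q (f.eval (n : ℤ)).natAbs) := by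
  simp only [polyAPSeq_a]
  -- `f(n) = v ↔ |f(n)| = v` on the index set
  have hfib : ∀ v : ℕ, (apIndex N q r).filter (fun n : ℕ => f.eval (n : ℤ) = (v : ℤ)) =
      (apIndex N q r).filter (fun n : ℕ => (f.eval (n : ℤ)).natAbs = v) := by
    intro v
    refine Finset.filter_congr fun n hn => ?_
    have h0 := (hx n hn).1
    constructor
    · intro h; rw [h, Int.natAbs_natCast]
    · intro h; rw [← h, Int.natAbs_of_nonneg h0.le]
  simp_rw [hfib]
  rw [← Nat.cast_sum, Finset.sum_card_fiberwise_eq_card_filter]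
  congr 2
  ext n
  simp only [Finset.mem_filter, Finset.mem_Ioc, and_congr_right_iff]
  intro hn
  obtain ⟨h0, hle⟩ := hx n hn
  have hv0 : 0 < (f.eval (n : ℤ)).natAbs := Int.natAbs_pos.mpr h0.ne'
  have hvx : (f.eval (n : ℤ)).natAbs ≤ ⌊x⌋₊ := by
    refine Nat.le_floor ?_
    have : (((f.eval (n : ℤ)).natAbs : ℤ) : ℝ) = ((f.eval (n : ℤ) : ℤ) : ℝ) := by
      rw [Int.natAbs_of_nonneg h0.le]
    rw [← Int.cast_natCast, this]
    exact hle
  exact ⟨fun h => h.2, fun h => ⟨⟨hv0, hvx⟩, h⟩⟩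

/-- **The sifting function counts:** `S(𝒜, P; x) = #{n ∈ apIndex N q r : (f(n), P) = 1}` once
`0 < f(n) ≤ x` on the index set. [folklore] -/
theorem polyAPSeq_sifted (f : ℤ[X]) (N q r : ℕ) {x : ℝ}
    (hx : ∀ n ∈ apIndex N q r, 0 < f.eval (n : ℤ) ∧ ((f.eval (n : ℤ) : ℤ) : ℝ) ≤ x) (P : ℕ) :
    (polyAPSeq f N q r).sifted x P =
      #((apIndex N q r).filter fun n : ℕ => (f.eval (n : ℤ)).natAbs.Coprime P) :=
  sum_filter_polyAPSeq_a_eq_card f N q r hx _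

/-- **The congruence sums count:** `A_m(x) = #{n ∈ apIndex N q r : m ∣ f(n)}` once
`0 < f(n) ≤ x` on the index set. [folklore] -/
theorem polyAPSeq_congrSum (f : ℤ[X]) (N q r : ℕ) {x : ℝ}
    (hx : ∀ n ∈ apIndex N q r, 0 < f.eval (n : ℤ) ∧ ((f.eval (n : ℤ) : ℤ) : ℝ) ≤ x) (m : ℕ) :
    (polyAPSeq f N q r).congrSum m x =
      #((apIndex N q r).filter fun n : ℕ => (m : ℤ) ∣ f.eval (n : ℤ)) := by
  rw [SieveSequence.congrSum, sum_filter_polyAPSeq_a_eq_card f N q r hx]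
  congr 2
  refine Finset.filter_congr fun n _ => ?_
  exact Int.natCast_dvd.symm

/-- `V(P(z)) = ∏_{p < z} (1 − ω_f(p)/p)` for the polynomial sequence. [folklore] -/
theorem polyAPSeq_densityProduct (f : ℤ[X]) (N q r : ℕ) (z : ℝ) :
    (polyAPSeq f N q r).densityProduct (primesProdBelow z) =
      ∏ p ∈ Nat.primesBelow ⌈z⌉₊, (1 - (polyRootCountMod ![f] p : ℝ) / p) := by
  rw [SieveSequence.densityProduct, primeFactors_primesProdBelow]
  rfl

/-- **The remainder bound** (Halberstam–Richert Ch. 1, Example 5): for `m ≥ 1` coprime to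
`q ≥ 1`, `|R_m(x)| = |A_m(x) − (ω_f(m)/m)(N/q)| ≤ ω_f(m)` (each of the `ω_f(m)` admissible
classes mod `m` meets the progression in `N/(qm) + O(1)` points), once `0 < f(n) ≤ x` on the
index set. [folklore] -/
theorem abs_remainder_polyAPSeq_le (f : ℤ[X]) {N q r m : ℕ} (hq : 0 < q) (hm : 0 < m)
    (hqm : q.Coprime m) {x : ℝ}
    (hx : ∀ n ∈ apIndex N q r, 0 < f.eval (n : ℤ) ∧ ((f.eval (n : ℤ) : ℤ) : ℝ) ≤ x) :
    |(polyAPSeq f N q r).remainder m x| ≤ polyRootCountMod ![f] m := by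
  rw [SieveSequence.remainder, polyAPSeq_congrSum f N q r hx, polyAPSeq_size, polyAPSeq_density,
    rootDensity_apply, card_filter_dvd_eval_eq_sum f _ hm, ← card_filter_dvd_eval_eq_polyRootCountMod f m]
  set T := (range m).filter (fun s : ℕ => (m : ℤ) ∣ f.eval (s : ℤ)) with hT
  have hrw : (#T : ℝ) / m * ((N : ℝ) / q) = ∑ _s ∈ T, (N : ℝ) / ((q : ℝ) * m) := by
    rw [Finset.sum_const, nsmul_eq_mul]
    have hm' : (m : ℝ) ≠ 0 := by exact_mod_cast hm.ne'
    have hq' : (q : ℝ) ≠ 0 := by exact_mod_cast hq.ne'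
    field_simp
  rw [hrw, Nat.cast_sum, ← Finset.sum_sub_distrib]
  refine (Finset.abs_sum_le_sum_abs _ _).trans ?_
  calc ∑ s ∈ T, |((#((apIndex N q r).filter fun n : ℕ => n ≡ s [MOD m]) : ℕ) : ℝ) -
          (N : ℝ) / ((q : ℝ) * m)|
      ≤ ∑ _s ∈ T, (1 : ℝ) :=
        Finset.sum_le_sum fun s _ => abs_card_apIndex_filter_modEq_sub_le hq hm hqm N r s
    _ = #T := by rw [Finset.sum_const, nsmul_eq_mul, mul_one]

/-- Every divisor of `P(z)` is coprime to `q` as soon as no prime `< z` divides `q`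
(e.g. `q = 1`, or `q` a prime `≥ z`). [folklore] -/
theorem coprime_of_dvd_primesProdBelow {q m : ℕ} {z : ℝ}
    (hqz : ∀ p : ℕ, p.Prime → (p : ℝ) < z → ¬ p ∣ q) (hm : m ∣ primesProdBelow z) :
    q.Coprime m := by
  refine Nat.Coprime.symm (Nat.coprime_of_dvd fun p hp hpm hpq => hqz p hp ?_ hpq)
  exact (dvd_primesProdBelow_iff hp z).mp (hpm.trans hm)

/-- **The remainder sum of the Fundamental Lemma** for the polynomial sequence: if no prime `< z`
divides `q ≥ 1` and `0 < f(n) ≤ x` on the index set, then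
`∑_{m ∣ P(z), m ≤ D} |R_m(x)| ≤ ∑_{m ∣ P(z), m ≤ D} ω_f(m)`. [folklore] -/
theorem sum_abs_remainder_polyAPSeq_le (f : ℤ[X]) {N q r : ℕ} (hq : 0 < q) {x z D : ℝ}
    (hqz : ∀ p : ℕ, p.Prime → (p : ℝ) < z → ¬ p ∣ q)
    (hx : ∀ n ∈ apIndex N q r, 0 < f.eval (n : ℤ) ∧ ((f.eval (n : ℤ) : ℤ) : ℝ) ≤ x) :
    ∑ m ∈ (primesProdBelow z).divisors.filter (fun m : ℕ => (m : ℝ) ≤ D),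
        |(polyAPSeq f N q r).remainder m x| ≤
      ∑ m ∈ (primesProdBelow z).divisors.filter (fun m : ℕ => (m : ℝ) ≤ D),
        (polyRootCountMod ![f] m : ℝ) := by
  refine Finset.sum_le_sum fun m hm => ?_
  obtain ⟨hmd, -⟩ := Finset.mem_filter.mp hm
  have hmP : m ∣ primesProdBelow z := Nat.dvd_of_mem_divisors hmd
  have hm0 : 0 < m := Nat.pos_of_mem_divisors hmd
  exact abs_remainder_polyAPSeq_le f hq hm0 (coprime_of_dvd_primesProdBelow hqz hmP) hx

end Literature.NumberTheory.Sieve
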